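import Literature.Topology.FourManifolds.RegularLevelSplitting
import Literature.Topology.FourManifolds.Gluing
import Literature.Geometry.Manifold.EmbeddingRangeDiffeomorph
import Mathlib.Geometry.Manifold.SmoothEmbedding
import Mathlib.Analysis.SpecialFunctions.SmoothTransition
import HarnessLib

/-!
# Stub `stub_levelSplitting` of line `property-r-mazur-halves` for crux `ConvexBisection.ContractibleTwistedDoubleStandard`
(item stmt-SmoothPoincare4-3546, route route-SmoothPoincare4-ConvexBisection)

**Level splitting of a closed `4`-manifold along an interior regular level of one half** (pure
differential topology).  Let the closed `4`-manifold `X = e₁(W₁) ∪ e₂(W₂)` be covered by two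
smoothly embedded compact `∂`-manifolds meeting exactly along `e₂(∂W₂)`, let `f : W₂ → ℝ` be
smooth with `∂W₂ = {f = max f}`, and let `c < max f` be a level through no critical point of `f`
with `{f < c} ≠ ∅`.  Then `X` is a boundary gluing `P ∪_φ V` of two compact `4`-manifolds with
boundary with EXPLICIT smooth embeddings `jV : V → X` onto `e₂({f ≤ c})` and `jP : P → X` onto
`e₁(W₁) ∪ e₂({c ≤ f})`, covering `X` and meeting exactly along `∂P ≅ ∂V`
(`stub_levelSplitting`, the registered statement of the skeleton of line
`property-r-mazur-halves`).

Proof.  (1) `exists_cutoff`: a smooth `ρ : ℝ → ℝ`, the identity below `c + ε`, constant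
`max f + 1` above `max f - ε`, with `t ≤ ρ t`.  (2) `exists_levelFunction`: the function
`F = ρ ∘ f ∘ e₂⁻¹` on the open set `X ∖ e₁(W₁) ⊆ e₂(W₂)`, `F ≡ max f + 1` on `e₁(W₁)`, is smooth —
`e₂⁻¹` is smooth on `X ∖ e₁(W₁)` since a smooth map into the image of an embedding factors
smoothly through it (`Literature.Geometry.Manifold.exists_contMDiff_comp_eq_of_range_subset`, no
inverse function theorem), and `F` is constant on the open neighbourhood
`X ∖ e₂({f ≤ max f - ε})` of `e₁(W₁)` — has regular level `c` (near `{F = c}` one has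
`F ∘ e₂ = f`; chain rule), `{F ≤ c} = e₂({f ≤ c})` and `{c ≤ F} = e₁(W₁) ∪ e₂({c ≤ f})`.
(3) `V = {F ≤ c}`, `P = {c ≤ F}` are the regular sublevel and superlevel sets of
`Literature.Topology.FourManifolds.RegularSublevel` (`RegularLevelSplitting.lean`, Milnor 1963,
Thm. 3.1), glued along `{F = c}` exactly as in `RegularSublevel.isBoundaryGluing_split` with the
pieces swapped.

References: M. W. Hirsch, *Differential Topology* (1976), §4.4 and §8.2; J. Milnor, *Morse
theory* (1963), Thm. 3.1; J. Milnor, *Lectures on the h-cobordism theorem* (1965), §1, Thm. 3.4.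
-/

noncomputable section

-- the prescribed namespace `Summit.<P>.<Sub>.…` duplicates `SmoothPoincare4` (P = Sub)
set_option linter.dupNamespace false

open scoped Manifold ContDiff Topology
open Set Function Literature.Topology.FourManifolds

namespace Summit.SmoothPoincare4.SmoothPoincare4.Theorems.ContractibleTwistedDoubleStandard.PropertyRMazurHalves

/-! ### A smooth cutoff reparametrisation of the target line -/

/-- **Cutoff.**  For `c < m` there are `ε > 0` with `c + 2ε < m` and a smooth `ρ : ℝ → ℝ` which
is the identity on `(-∞, c + ε]`, constant `= m + 1` on `[m - ε, ∞)`, and satisfies `t ≤ ρ t`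
for `t ≤ m + 1` (built from `Real.smoothTransition`). [folklore] -/
private theorem exists_cutoff {c m : ℝ} (hcm : c < m) :
    ∃ (ρ : ℝ → ℝ) (ε : ℝ), 0 < ε ∧ c + 2 * ε < m ∧ ContDiff ℝ ∞ ρ ∧
      (∀ t, t ≤ c + ε → ρ t = t) ∧ (∀ t, m - ε ≤ t → ρ t = m + 1) ∧
      (∀ t, t ≤ m + 1 → t ≤ ρ t) := by
  refine ⟨fun t => t + Real.smoothTransition ((t - (c + (m - c) / 3)) / ((m - c) / 3)) *
      (m + 1 - t), (m - c) / 3, by linarith, by linarith, ?_, ?_, ?_, ?_⟩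
  · exact contDiff_id.add
      ((Real.smoothTransition.contDiff.comp ((contDiff_id.sub contDiff_const).div_const _)).mul
        (contDiff_const.sub contDiff_id))
  · intro t ht
    have h0 : (t - (c + (m - c) / 3)) / ((m - c) / 3) ≤ 0 :=
      div_nonpos_of_nonpos_of_nonneg (by linarith) (by linarith)
    dsimp only
    simp only [Real.smoothTransition.zero_of_nonpos h0, zero_mul, add_zero]
  · intro t ht
    have h1 : 1 ≤ (t - (c + (m - c) / 3)) / ((m - c) / 3) := by
      rw [le_div_iff₀ (by linarith)]
      linarith
    dsimp only
    rw [Real.smoothTransition.one_of_one_le h1]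
    ring
  · intro t ht
    dsimp only
    have h0 := Real.smoothTransition.nonneg ((t - (c + (m - c) / 3)) / ((m - c) / 3))
    exact le_add_of_nonneg_right (mul_nonneg h0 (by linarith))

/-! ### Smoothness by open cover: smooth on an open submanifold, constant on an open set -/

/-- A function on a charted space which is `C^n` on an open subset `U` (as a function on the
open submanifold `U`) and constant on an open subset `O`, with `U ∪ O` everything, is `C^n`.
[folklore] -/
private theorem contMDiff_of_opens_of_const {E H : Type*} [NormedAddCommGroup E] [NormedSpace ℝ E]
    [TopologicalSpace H] {I : ModelWithCorners ℝ E H} {M : Type*} [TopologicalSpace M]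
    [ChartedSpace H M] {n : ℕ∞ω} {F : M → ℝ} (U O : TopologicalSpace.Opens M)
    (hUO : ∀ x, x ∈ U ∨ x ∈ O) (hU : ContMDiff I 𝓘(ℝ, ℝ) n fun x : U => F x) (K : ℝ)
    (hO : ∀ x ∈ O, F x = K) : ContMDiff I 𝓘(ℝ, ℝ) n F := by
  intro x
  rcases hUO x with hx | hx
  · exact (contMDiffAt_subtype_iff (U := U) (x := ⟨x, hx⟩)).1 (hU ⟨x, hx⟩)
  · refine (contMDiffAt_const (c := K)).congr_of_eventuallyEq ?_
    exact Filter.eventuallyEq_of_mem (O.isOpen.mem_nhds hx) fun y hy => hO y hy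

/-! ### The level function on the closed manifold -/

/-- **Smooth extension of `f ∘ e₂⁻¹` to the closed manifold, cut off above the level.**  Let
`X = e₁(W₁) ∪ e₂(W₂)` with `e₂` a smooth embedding of a compact `∂`-manifold, the two images
meeting exactly along `e₂(∂W₂)`, and let `f : W₂ → ℝ` be smooth with `∂W₂ = {f = max f}` and
`c < max f` a level through no critical point.  Then there is a smooth `F : X → ℝ` with regular
level `c` such that `{F ≤ c} = e₂({f ≤ c})` and `{c ≤ F} = e₁(W₁) ∪ e₂({c ≤ f})`.  Construction:
`F = ρ ∘ f ∘ e₂⁻¹` on the open set `X ∖ e₁(W₁) ⊆ e₂(W₂)` and `F ≡ max f + 1` on `e₁(W₁)`, for the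
cutoff `ρ` of `exists_cutoff`; `e₂⁻¹` is smooth on `X ∖ e₁(W₁)` because a smooth map into the
image of an embedding factors smoothly through it
(`Literature.Geometry.Manifold.exists_contMDiff_comp_eq_of_range_subset`), and the two local
descriptions overlap on an open cover of `X`.  Regularity of the level `c`: near a point of
`{F = c} = e₂({f = c})` one has `F ∘ e₂ = f`, so a critical point of `F` would be one of `f`
(chain rule). [cite: HirschDT1976, §4.4 and §8.2] -/
private theorem exists_levelFunction
    {X : Type*} [TopologicalSpace X] [T2Space X] [ChartedSpace (EuclideanSpace ℝ (Fin 4)) X]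
    [IsManifold (𝓡 4) ∞ X]
    {W₁ : Type*} [TopologicalSpace W₁] [CompactSpace W₁]
    {W₂ : Type*} [TopologicalSpace W₂] [ChartedSpace (EuclideanHalfSpace 4) W₂] [CompactSpace W₂]
    [Nonempty W₂]
    {e₁ : W₁ → X} {e₂ : W₂ → X} (h1 : Continuous e₁)
    (h2 : Manifold.IsSmoothEmbedding (𝓡∂ 4) (𝓡 4) ∞ e₂)
    (hcov : range e₁ ∪ range e₂ = univ) (hR : range e₁ ∩ range e₂ = e₂ '' (𝓡∂ 4).boundary W₂)
    {f : W₂ → ℝ} (hf : ContMDiff (𝓡∂ 4) 𝓘(ℝ, ℝ) ∞ f)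
    (hbd : ∀ x, (𝓡∂ 4).IsBoundaryPoint x ↔ f x = sSup (range f))
    {c : ℝ} (hc : c < sSup (range f)) (hreg : ∀ z, IsMCriticalPt (𝓡∂ 4) f z → f z ≠ c) :
    ∃ F : X → ℝ, IsRegularLevel (𝓡 4) F c ∧
      (∀ x, F x ≤ c ↔ x ∈ e₂ '' (f ⁻¹' Iic c)) ∧
      (∀ x, c ≤ F x ↔ x ∈ range e₁ ∪ e₂ '' (f ⁻¹' Ici c)) := by
  classical
  -- notation and elementary facts
  set m : ℝ := sSup (range f) with hm
  have hfle : ∀ w, f w ≤ m := fun w =>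
    le_csSup (isCompact_range hf.continuous).bddAbove (mem_range_self w)
  have hcov' : ∀ x, x ∉ range e₁ → x ∈ range e₂ := fun x hx =>
    ((Set.ext_iff.1 hcov x).2 (mem_univ x)).resolve_left hx
  have hseam : ∀ w, e₂ w ∈ range e₁ → f w = m := by
    intro w hw
    have hw' : e₂ w ∈ e₂ '' (𝓡∂ 4).boundary W₂ := by
      rw [← hR]
      exact ⟨hw, mem_range_self w⟩
    obtain ⟨w', hb, he⟩ := hw'
    obtain rfl := h2.isEmbedding.injective he
    exact (hbd _).1 hb
  -- the cutoff and the extension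
  obtain ⟨ρ, ε, hε, hε2, hρs, hρ1, hρ2, hρ3⟩ := exists_cutoff hc
  set σ : X → W₂ := Function.invFun e₂ with hσdef
  have hσ : ∀ w, σ (e₂ w) = w := Function.leftInverse_invFun h2.isEmbedding.injective
  set F : X → ℝ := fun x => if x ∈ range e₁ then m + 1 else ρ (f (σ x)) with hFdef
  have hF1 : ∀ x ∈ range e₁, F x = m + 1 := fun x hx => if_pos hx
  have hF2 : ∀ w, F (e₂ w) = ρ (f w) := by
    intro w
    by_cases hw : e₂ w ∈ range e₁
    · rw [hF1 _ hw, hseam w hw, hρ2 m (by linarith)]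
    · have h : F (e₂ w) = ρ (f (σ (e₂ w))) := if_neg hw
      rw [h, hσ]
  -- values of `ρ ∘ f`
  have hρle : ∀ w, ρ (f w) ≤ c ↔ f w ≤ c := by
    intro w
    constructor
    · intro h
      by_contra hlt
      have hlt' := not_le.1 hlt
      have h' := hρ3 (f w) (by linarith [hfle w])
      linarith
    · intro h
      rw [hρ1 _ (by linarith)]
      exact h
  have hρge : ∀ w, c ≤ ρ (f w) ↔ c ≤ f w := by
    intro w
    constructor
    · intro h
      by_contra hlt
      have hlt' := not_le.1 hlt
      rw [hρ1 _ (by linarith)] at h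
      exact hlt h
    · intro h
      exact h.trans (hρ3 (f w) (by linarith [hfle w]))
  -- smoothness of `F` on the open set `X ∖ e₁(W₁)`
  set U : TopologicalSpace.Opens X :=
    ⟨(range e₁)ᶜ, (isCompact_range h1).isClosed.isOpen_compl⟩ with hUdef
  have hUsub : range (Subtype.val : U → X) ⊆ range e₂ := by
    rintro _ ⟨x, rfl⟩
    exact hcov' x.1 x.2
  obtain ⟨g, hg, hge⟩ := Literature.Geometry.Manifold.exists_contMDiff_comp_eq_of_range_subset h2
    (contMDiff_subtype_val (I := 𝓡 4) (n := ∞) (U := U)) hUsub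
  have hFU : (fun x : U => F x) = ρ ∘ f ∘ g := by
    funext x
    have hxe : e₂ (g x) = x := congrFun hge x
    rw [← hxe]
    exact hF2 (g x)
  have hUsmooth : ContMDiff (𝓡 4) 𝓘(ℝ, ℝ) ∞ fun x : U => F x := by
    rw [hFU]
    exact (hρs.comp_contMDiff hf).comp hg
  -- `F` is constant on the open set `X ∖ e₂({f ≤ m - ε}) ⊇ e₁(W₁)`
  set O : TopologicalSpace.Opens X := ⟨(e₂ '' (f ⁻¹' Iic (m - ε)))ᶜ,
    (((isClosed_Iic.preimage hf.continuous).isCompact.image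
      h2.isEmbedding.continuous).isClosed).isOpen_compl⟩ with hOdef
  have hUO : ∀ x, x ∈ U ∨ x ∈ O := by
    intro x
    by_cases hx : x ∈ range e₁
    · refine Or.inr ?_
      show x ∉ e₂ '' (f ⁻¹' Iic (m - ε))
      rintro ⟨w, hw, rfl⟩
      have h := hseam w hx
      simp only [mem_preimage, mem_Iic] at hw
      linarith
    · exact Or.inl hx
  have hO : ∀ x ∈ O, F x = m + 1 := by
    intro x hx
    by_cases h : x ∈ range e₁
    · exact hF1 x h
    · obtain ⟨w, rfl⟩ := hcov' x h
      rw [hF2]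
      apply hρ2
      by_contra hlt
      exact absurd (⟨w, (not_le.1 hlt).le, rfl⟩ : e₂ w ∈ e₂ '' (f ⁻¹' Iic (m - ε))) hx
  have hF : ContMDiff (𝓡 4) 𝓘(ℝ, ℝ) ∞ F :=
    contMDiff_of_opens_of_const U O hUO hUsmooth (m + 1) hO
  -- `c` is a regular level of `F`
  have hval : ∀ w, ρ (f w) = c → f w = c := fun w h =>
    le_antisymm ((hρle w).1 h.le) ((hρge w).1 h.ge)
  have hreg' : ∀ x, F x = c → ¬ IsMCriticalPt (𝓡 4) F x := by
    intro x hx hcrit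
    have hx1 : x ∉ range e₁ := fun h => by
      rw [hF1 x h] at hx
      linarith
    obtain ⟨w, rfl⟩ := hcov' x hx1
    rw [hF2] at hx
    have hfw : f w = c := hval w hx
    have hev : (F ∘ e₂) =ᶠ[𝓝 w] f := by
      have hlt : ∀ᶠ y in 𝓝 w, f y < c + ε :=
        hf.continuous.continuousAt.eventually_lt continuousAt_const
          (show f w < c + ε by linarith)
      filter_upwards [hlt] with y hy
      show F (e₂ y) = f y
      rw [hF2, hρ1 _ hy.le]
    have hd : mfderiv (𝓡∂ 4) 𝓘(ℝ, ℝ) (F ∘ e₂) w = 0 := by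
      rw [mfderiv_comp w (hF.mdifferentiableAt (by simp))
        (h2.contMDiff.mdifferentiableAt (by simp))]
      have h0 : mfderiv (𝓡 4) 𝓘(ℝ, ℝ) F (e₂ w) = 0 := hcrit
      rw [h0, ContinuousLinearMap.zero_comp]
      rfl
    refine hreg w ?_ hfw
    show mfderiv (𝓡∂ 4) 𝓘(ℝ, ℝ) f w = 0
    rw [← hev.mfderiv_eq]
    exact hd
  refine ⟨F, isRegularLevel_of_not_isMCriticalPt hF hreg', fun x => ?_, fun x => ?_⟩
  · -- the sublevel set `{F ≤ c} = e₂({f ≤ c})`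
    by_cases hx : x ∈ range e₁
    · rw [hF1 x hx]
      constructor
      · intro h
        exfalso
        linarith
      · rintro ⟨w, hw, rfl⟩
        have h := hseam w hx
        simp only [mem_preimage, mem_Iic] at hw
        linarith
    · obtain ⟨w, rfl⟩ := hcov' x hx
      rw [hF2, hρle]
      constructor
      · intro h
        exact ⟨w, h, rfl⟩
      · rintro ⟨w', hw', he⟩
        obtain rfl := h2.isEmbedding.injective he
        exact hw'
  · -- the superlevel set `{c ≤ F} = e₁(W₁) ∪ e₂({c ≤ f})`
    by_cases hx : x ∈ range e₁
    · rw [hF1 x hx]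
      exact ⟨fun _ => Or.inl hx, fun _ => by linarith⟩
    · obtain ⟨w, rfl⟩ := hcov' x hx
      rw [hF2, hρge]
      constructor
      · intro h
        exact Or.inr ⟨w, h, rfl⟩
      · rintro (h | ⟨w', hw', he⟩)
        · exact absurd h hx
        · obtain rfl := h2.isEmbedding.injective he
          exact hw'

/-! ### The stub -/

/-- **Stub `stub_levelSplitting` (level splitting of the closed manifold along an interior
regular level of one half).**  Let `X = e₁(W₁) ∪ e₂(W₂)` be covered by two smoothly embedded
compact pieces meeting exactly along the images of both boundaries, and let `f : W₂ → ℝ` be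
smooth with `∂W₂ = {f = max f}` and `c < max f` a level through no critical point, with
`{f < c} ≠ ∅`.  Then `X` is a boundary gluing `P ∪_φ V` of two compact `4`-manifolds with
boundary, realised by smooth embeddings `jV : V → X` onto `e₂({f ≤ c})` and `jP : P → X` onto
`e₁(W₁) ∪ e₂({c ≤ f})`, meeting exactly along `∂P ≅ ∂V` through a diffeomorphism `φ` of the
boundary data.  Proof: `exists_levelFunction` extends `f ∘ e₂⁻¹` (cut off above `c`) to a smooth
`F : X → ℝ` with regular level `c`, `{F ≤ c} = e₂({f ≤ c})` and `{c ≤ F} = e₁(W₁) ∪ e₂({c ≤ f})`;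
then `V = {F ≤ c}` and `P = {c ≤ F}` are the regular sub- and superlevel sets of `F`
(`Literature.Topology.FourManifolds.RegularSublevel`, `RegularSuperlevel`: compact `∂`-manifolds
smoothly embedded by their inclusions, Milnor 1963, Thm. 3.1), which cover `X` and meet exactly
along the level `{F = c} = ∂V ≡ ∂P` (`RegularSublevel.splitDiffeomorph`, the identity on points),
exactly as in `RegularSublevel.isBoundaryGluing_split` with the two pieces swapped.  Hirsch,
*Differential Topology* (1976), §4.4 and §8.2; Milnor, *Lectures on the h-cobordism theorem*
(1965), §1 and Thm. 3.4. [cite: HirschDT1976, §4.4 and §8.2] -/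
theorem stub_levelSplitting :
    ∀ (X : Type) [TopologicalSpace X] [T2Space X] [SecondCountableTopology X] [CompactSpace X]
      [ChartedSpace (EuclideanSpace ℝ (Fin 4)) X] [IsManifold (𝓡 4) ∞ X]
      (W₁ : Type) [TopologicalSpace W₁] [ChartedSpace (EuclideanHalfSpace 4) W₁]
      [IsManifold (𝓡∂ 4) ∞ W₁] [CompactSpace W₁]
      (W₂ : Type) [TopologicalSpace W₂] [ChartedSpace (EuclideanHalfSpace 4) W₂]
      [IsManifold (𝓡∂ 4) ∞ W₂] [CompactSpace W₂] [ConnectedSpace W₂]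
      (e₁ : W₁ → X) (e₂ : W₂ → X),
      Manifold.IsSmoothEmbedding (𝓡∂ 4) (𝓡 4) ∞ e₁ → Manifold.IsSmoothEmbedding (𝓡∂ 4) (𝓡 4) ∞ e₂ →
      Set.range e₁ ∪ Set.range e₂ = Set.univ →
      Set.range e₁ ∩ Set.range e₂ = e₁ '' (𝓡∂ 4).boundary W₁ →
      Set.range e₁ ∩ Set.range e₂ = e₂ '' (𝓡∂ 4).boundary W₂ →
      ∀ (f : W₂ → ℝ), ContMDiff (𝓡∂ 4) 𝓘(ℝ, ℝ) ∞ f →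
      (∀ x, (𝓡∂ 4).IsBoundaryPoint x ↔ f x = sSup (Set.range f)) →
      ∀ (c : ℝ), c < sSup (Set.range f) → (∃ w, f w < c) →
      (∀ z, IsMCriticalPt (𝓡∂ 4) f z → f z ≠ c) →
      ∃ (P : Type) (_ : TopologicalSpace P) (_ : T2Space P) (_ : SecondCountableTopology P)
        (_ : ChartedSpace (EuclideanHalfSpace 4) P) (_ : IsManifold (𝓡∂ 4) ∞ P) (_ : CompactSpace P)
        (V : Type) (_ : TopologicalSpace V) (_ : T2Space V) (_ : SecondCountableTopology V)
        (_ : ChartedSpace (EuclideanHalfSpace 4) V) (_ : IsManifold (𝓡∂ 4) ∞ V) (_ : CompactSpace V)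
        (bP : BoundaryData (𝓡∂ 4) P (𝓡 3)) (bV : BoundaryData (𝓡∂ 4) V (𝓡 3))
        (φ : bP.carrier ≃ₘ⟮𝓡 3, 𝓡 3⟯ bV.carrier) (jP : P → X) (jV : V → X),
        Manifold.IsSmoothEmbedding (𝓡∂ 4) (𝓡 4) ∞ jP ∧ Manifold.IsSmoothEmbedding (𝓡∂ 4) (𝓡 4) ∞ jV ∧
        Set.range jP ∪ Set.range jV = Set.univ ∧
        (∀ a b, jP a = jV b ↔ ∃ z, a = bP.incl z ∧ b = bV.incl (φ z)) ∧
        Set.range jV = e₂ '' (f ⁻¹' Set.Iic c) ∧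
        Set.range jP = Set.range e₁ ∪ e₂ '' (f ⁻¹' Set.Ici c) := by

  intro X _ _ _ _ _ _ W₁ _ _ _ _ W₂ _ _ _ _ _ e₁ e₂ h1 h2 hcov _hL hR f hf hbd c hc hw hreg
  obtain ⟨w₀, -⟩ := hw
  haveI : Nonempty W₂ := ⟨w₀⟩
  obtain ⟨F, hF, hle, hge⟩ :=
    exists_levelFunction h1.isEmbedding.continuous h2 hcov hR hf hbd hc hreg
  refine ⟨RegularSuperlevel hF, inferInstance, inferInstance, inferInstance, inferInstance,
    inferInstance, inferInstance, RegularSublevel hF, inferInstance, inferInstance, inferInstance,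
    inferInstance, inferInstance, inferInstance, RegularSublevel.boundaryData hF.const_sub,
    RegularSublevel.boundaryData hF, (RegularSublevel.splitDiffeomorph hF).symm,
    RegularSublevel.incl hF.const_sub, RegularSublevel.incl hF,
    RegularSublevel.isSmoothEmbedding_incl _, RegularSublevel.isSmoothEmbedding_incl _,
    ?_, ?_, ?_, ?_⟩
  · -- the two pieces cover `X`
    apply eq_univ_of_forall
    intro x
    rcases le_total (F x) c with hx | hx
    · exact Or.inr ⟨RegularSublevel.mk hF x hx, rfl⟩
    · exact Or.inl ⟨RegularSublevel.mk hF.const_sub x ((level_le_iff_const_sub_nonpos x).1 hx), rfl⟩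
  · -- the pieces meet exactly along `∂P ≅ ∂V`
    intro p q
    constructor
    · intro hpq
      have hp : c ≤ F (RegularSublevel.incl hF.const_sub p) :=
        (level_le_iff_const_sub_nonpos _).2 (RegularSublevel.apply_incl_le _ p)
      have hqc : F (RegularSublevel.incl hF q) = c :=
        le_antisymm (RegularSublevel.apply_incl_le hF q) (by rw [← hpq]; exact hp)
      have hqb : q ∈ (𝓡∂ 4).boundary (RegularSublevel hF) :=
        (RegularSublevel.mem_boundary_iff hF q).2 hqc
      refine ⟨RegularSublevel.splitDiffeomorph hF ⟨q, hqb⟩, ?_, ?_⟩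
      · apply RegularSublevel.injective_incl
        show RegularSublevel.incl hF.const_sub p = RegularSublevel.incl hF.const_sub
          (RegularSublevel.splitDiffeomorph hF ⟨q, hqb⟩).1
        rw [RegularSublevel.incl_splitDiffeomorph]
        exact hpq
      · exact congrArg Subtype.val
          ((RegularSublevel.splitDiffeomorph hF).symm_apply_apply ⟨q, hqb⟩).symm
    · rintro ⟨z, rfl, rfl⟩
      have h := RegularSublevel.incl_splitDiffeomorph hF ((RegularSublevel.splitDiffeomorph hF).symm z)
      rw [Diffeomorph.apply_symm_apply] at h
      exact h
  · -- `jV(V) = {F ≤ c} = e₂({f ≤ c})`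
    rw [RegularSublevel.range_incl]
    ext x
    exact hle x
  · -- `jP(P) = {c ≤ F} = e₁(W₁) ∪ e₂({c ≤ f})`
    rw [RegularSublevel.range_incl]
    ext x
    rw [← hge x]
    simp only [mem_preimage, mem_Iic, sub_nonpos]

end Summit.SmoothPoincare4.SmoothPoincare4.Theorems.ContractibleTwistedDoubleStandard.PropertyRMazurHalves

end
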